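import Summits.MatrixMultiplication.MatrixMultiplication.Theorems.SoloBlindHypergraph
import Mathlib.LinearAlgebra.Quotient.Basic
import Mathlib.LinearAlgebra.Finsupp.LinearCombination

/-!
# Realisation: Conjecture E implies the hypergraph Kraft conjecture (so the two are equivalent)

Sub-programme (K₃).  `SoloBlindHypergraph` proved (♣) ⟹ E (`soloBlind_conjE_of_hgKraft`).  Here the converse:
an admissible hypergraph `(F, P)` (edges `⊆ F`) is REALISED inside the representation family of an H-good target
of a zero-sum-free sequence, so Conjecture E (for all index types and all exponent-`3` groups of the universe of
`W`) implies `soloBlindHgKraftConj W` (`soloBlind_hgKraft_of_conjE`).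

CONSTRUCTION.  Index set = `Finset W` with `S = P` (the edges are the elements); module `M = (Finset W → 𝔽₃)`;
star vectors `s_v = 𝟙_{J ∈ P, v ∈ J}`; relation module `L = span {s_v - s_{v₀} : v ∈ F}` (`v₀ ∈ F` fixed);
`G = M ⧸ L` (exponent `3`), `h(J) = [e_J]`, `σ = [s_{v₀}]`.  The star `T_v = {J ∈ P : v ∈ J}` of every vertex
is a representation of `σ` (`∑_{J ∈ T_v} e_J = s_v ≡ s_{v₀}`), distinct vertices have distinct stars
(separation), and `|T_v| = deg v`; so `∑_v 2^{-deg v} ≤ soloBlindMass h P σ`.  ZERO-SUM FREENESS and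
H-GOODNESS: a relation `𝟙_T ∈ L` (resp. `𝟙_T - 2 s_{v₀} ∈ L`) unpacks (`soloBlind_relMod_functional`) into a
functional `c : F → 𝔽₃` of total `0` (resp., after a shift, total `1` with values in `{0, 2}`) whose value on
every edge `J` is `[J ∈ T] ∈ {0, 1}` — excluded by admissibility.
-/

namespace Summit.MatrixMultiplication.MatrixMultiplication.Theorems

open Finset

universe u

variable {W : Type u} [DecidableEq W]

/-- The star vector of the vertex `v`: indicator of the edges of `P` containing `v`. -/
def soloBlindStarVec (P : Finset (Finset W)) (v : W) : Finset W → ZMod 3 :=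
  fun J => if J ∈ P ∧ v ∈ J then 1 else 0

/-- The indicator vector of a family of edges. -/
def soloBlindIndVec (T : Finset (Finset W)) : Finset W → ZMod 3 :=
  fun J => if J ∈ T then 1 else 0

/-- The relation module `L = span {s_v - s_{v₀} : v ∈ F}`. -/
def soloBlindRelMod (F : Finset W) (P : Finset (Finset W)) (v₀ : W) :
    Submodule (ZMod 3) (Finset W → ZMod 3) :=
  Submodule.span (ZMod 3) (Set.range (fun v : ↥F => soloBlindStarVec P v.1 - soloBlindStarVec P v₀))

/-- The realising sequence `J ↦ [e_J] ∈ M ⧸ L`. -/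
def soloBlindRealise (F : Finset W) (P : Finset (Finset W)) (v₀ : W) :
    Finset W → (Finset W → ZMod 3) ⧸ soloBlindRelMod F P v₀ :=
  fun J => (soloBlindRelMod F P v₀).mkQ (soloBlindIndVec {J})

/-- Sums of unit vectors are indicator vectors. -/
theorem soloBlind_sum_indVec_singleton (T : Finset (Finset W)) :
    ∑ J ∈ T, soloBlindIndVec ({J} : Finset (Finset W)) = soloBlindIndVec T := by
  funext K
  rw [Finset.sum_apply]
  simp only [soloBlindIndVec, Finset.mem_singleton]
  rw [Finset.sum_ite_eq T K (fun _ => (1 : ZMod 3))]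

/-- Sub-sums of the realising sequence: `∑_{J ∈ T} h J = [𝟙_T]`. -/
theorem soloBlind_realise_sum (F : Finset W) (P : Finset (Finset W)) (v₀ : W) (T : Finset (Finset W)) :
    ∑ J ∈ T, soloBlindRealise F P v₀ J = (soloBlindRelMod F P v₀).mkQ (soloBlindIndVec T) := by
  unfold soloBlindRealise
  rw [← map_sum, soloBlind_sum_indVec_singleton]

omit [DecidableEq W] in
/-- The quotient module has exponent `3`. -/
theorem soloBlind_quotMod_three (L : Submodule (ZMod 3) (Finset W → ZMod 3)) (g : (Finset W → ZMod 3) ⧸ L) :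
    g + g + g = 0 := by
  obtain ⟨x, rfl⟩ := Submodule.Quotient.mk_surjective L g
  have h3 : ∀ a : ZMod 3, a + a + a = 0 := by decide
  have hx : x + x + x = 0 := by
    funext K
    exact h3 (x K)
  rw [← Submodule.Quotient.mk_add, ← Submodule.Quotient.mk_add, hx, Submodule.Quotient.mk_zero]

/-- UNPACKING A RELATION: an element of `L` is, on the edges, the value pattern of a functional of total `0`. -/
theorem soloBlind_relMod_functional {F : Finset W} {P : Finset (Finset W)} (hPF : ∀ J ∈ P, J ⊆ F) {v₀ : W}
    (hv₀ : v₀ ∈ F) {x : Finset W → ZMod 3} (hx : x ∈ soloBlindRelMod F P v₀) :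
    ∃ c : W → ZMod 3, ∑ w ∈ F, c w = 0 ∧ ∀ J ∈ P, soloBlindHgVal c J = x J := by
  unfold soloBlindRelMod at hx
  obtain ⟨a, ha⟩ := (Submodule.mem_span_range_iff_exists_fun (R := ZMod 3)).mp hx
  -- coefficients as a function on `W`
  let b : W → ZMod 3 := fun w => if h : w ∈ F then a ⟨w, h⟩ else 0
  have hab : ∀ v : ↥F, a v = b v.1 := fun v => by simp [b, v.2]
  have hBsum : ∑ v : ↥F, a v = ∑ w ∈ F, b w := by
    rw [← Finset.sum_coe_sort F b]; exact Finset.sum_congr rfl (fun v _ => hab v)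
  refine ⟨fun w => b w - (if w = v₀ then ∑ w ∈ F, b w else 0), ?_, ?_⟩
  · rw [Finset.sum_sub_distrib, Finset.sum_ite_eq' F v₀ (fun _ => ∑ w ∈ F, b w), if_pos hv₀, sub_self]
  · intro J hJ
    have hJF := hPF J hJ
    -- value of the relation at `J`
    have hxJ : x J = ∑ v : ↥F, a v * ((if (v.1 : W) ∈ J then (1 : ZMod 3) else 0) -
        (if v₀ ∈ J then (1 : ZMod 3) else 0)) := by
      rw [← ha, Finset.sum_apply]
      refine Finset.sum_congr rfl (fun v _ => ?_)
      simp only [Pi.smul_apply, Pi.sub_apply, smul_eq_mul, soloBlindStarVec, hJ, true_and]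
    have h1 : ∑ v : ↥F, a v * (if (v.1 : W) ∈ J then (1 : ZMod 3) else 0) = ∑ w ∈ J, b w := by
      have e1 : ∑ v : ↥F, a v * (if (v.1 : W) ∈ J then (1 : ZMod 3) else 0) =
          ∑ w ∈ F, b w * (if w ∈ J then (1 : ZMod 3) else 0) := by
        rw [← Finset.sum_coe_sort F (fun w => b w * (if w ∈ J then (1 : ZMod 3) else 0))]
        exact Finset.sum_congr rfl (fun v _ => by rw [hab v])
      rw [e1, ← Finset.sum_subset hJF (fun w _ hw => by rw [if_neg hw, mul_zero])]
      exact Finset.sum_congr rfl (fun w hw => by rw [if_pos hw, mul_one])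
    have h2 : ∑ v : ↥F, a v * (if v₀ ∈ J then (1 : ZMod 3) else 0) =
        if v₀ ∈ J then ∑ w ∈ F, b w else 0 := by
      rw [← Finset.sum_mul, hBsum]
      split_ifs
      · rw [mul_one]
      · rw [mul_zero]
    unfold soloBlindHgVal
    rw [Finset.sum_sub_distrib, Finset.sum_ite_eq' J v₀ (fun _ => ∑ w ∈ F, b w), hxJ,
      Finset.sum_congr rfl (fun v _ => mul_sub (a v) _ _), Finset.sum_sub_distrib, h1, h2]

/-- The star of `v` (as a family of edges) has indicator vector `s_v`. -/
theorem soloBlind_indVec_star (P : Finset (Finset W)) (v : W) :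
    soloBlindIndVec (P.filter (fun J => v ∈ J)) = soloBlindStarVec P v := by
  funext J
  simp [soloBlindIndVec, soloBlindStarVec, Finset.mem_filter]

/-- REALISATION THEOREM: Conjecture E (all index types and all exponent-`3` groups in the universe of `W`)
implies the hypergraph Kraft conjecture over `W`. -/
theorem soloBlind_hgKraft_of_conjE
    (hE : ∀ {κ : Type u} {G' : Type u} [AddCommGroup G'] [DecidableEq G'],
      (∀ g : G', g + g + g = 0) → ∀ (h' : κ → G') (S' : Finset κ) (τ' : G'),
      (∀ T ⊆ S', T.Nonempty → ∑ i ∈ T, h' i ≠ 0) → (∀ T ⊆ S', ∑ i ∈ T, h' i ≠ τ' + τ') →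
      soloBlindMass h' S' τ' ≤ 1 / 2) :
    soloBlindHgKraftConj W := by
  classical
  intro F P hPF hadm
  obtain ⟨hsep, h1, h0⟩ := hadm
  by_cases hF : F = ∅
  · subst hF; simp [soloBlindHgKraft]
  obtain ⟨v₀, hv₀⟩ := Finset.nonempty_iff_ne_empty.mpr hF
  set L := soloBlindRelMod F P v₀ with hL
  let h : Finset W → (Finset W → ZMod 3) ⧸ L := soloBlindRealise F P v₀
  set σ : (Finset W → ZMod 3) ⧸ L := L.mkQ (soloBlindStarVec P v₀) with hσ
  -- values of a relation-functional are `[J ∈ T]`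
  have pattern : ∀ (T : Finset (Finset W)) (c : W → ZMod 3),
      (∀ J ∈ P, soloBlindHgVal c J = soloBlindIndVec T J) →
      (∀ J ∈ P, soloBlindHgVal c J = 2 → False) := by
    intro T c hc J hJ h2
    rw [hc J hJ] at h2
    unfold soloBlindIndVec at h2
    split_ifs at h2 <;> revert h2 <;> decide
  -- zero-sum freeness
  have zsf : ∀ T ⊆ P, T.Nonempty → ∑ J ∈ T, h J ≠ 0 := by
    intro T hTP hTne hsum
    have hmem : soloBlindIndVec T ∈ L := by
      have := hsum
      rw [soloBlind_realise_sum, Submodule.mkQ_apply, Submodule.Quotient.mk_eq_zero] at this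
      exact this
    obtain ⟨c, hc0, hcJ⟩ := soloBlind_relMod_functional hPF hv₀ hmem
    obtain ⟨J₀, hJ₀⟩ := hTne
    have hone : ∃ J ∈ P, soloBlindHgVal c J = 1 :=
      ⟨J₀, hTP hJ₀, by rw [hcJ J₀ (hTP hJ₀)]; simp [soloBlindIndVec, hJ₀]⟩
    obtain ⟨J, hJ, hJ2⟩ := (h0 c hc0).mp hone
    exact pattern T c hcJ J hJ hJ2
  -- H-goodness of σ
  have hgood : ∀ T ⊆ P, ∑ J ∈ T, h J ≠ σ + σ := by
    intro T hTP hsum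
    have hmem : soloBlindIndVec T - (soloBlindStarVec P v₀ + soloBlindStarVec P v₀) ∈ L := by
      have := hsum
      rw [hσ, soloBlind_realise_sum, Submodule.mkQ_apply, Submodule.mkQ_apply, ← Submodule.Quotient.mk_add,
        Submodule.Quotient.eq] at this
      exact this
    obtain ⟨c, hc0, hcJ⟩ := soloBlind_relMod_functional hPF hv₀ hmem
    -- shifted functional: total `1` after negation, values in `{0, 2}`
    let c' : W → ZMod 3 := fun w => 2 * c w + (if w = v₀ then 1 else 0)
    have hc'1 : ∑ w ∈ F, c' w = 1 := by
      simp only [c']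
      rw [Finset.sum_add_distrib, ← Finset.mul_sum, hc0, mul_zero, zero_add, Finset.sum_ite_eq' F v₀,
        if_pos hv₀]
    have hc'J : ∀ J ∈ P, soloBlindHgVal c' J = 2 * soloBlindIndVec T J := by
      intro J hJ
      have hv := hcJ J hJ
      unfold soloBlindHgVal at hv ⊢
      simp only [c']
      rw [Finset.sum_add_distrib, ← Finset.mul_sum, hv, Finset.sum_ite_eq' J v₀, Pi.sub_apply,
        Pi.add_apply]
      simp only [soloBlindStarVec, hJ, true_and]
      generalize soloBlindIndVec T J = y
      split_ifs <;> revert y <;> decide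
    obtain ⟨J, hJ, hJ1⟩ := h1 c' hc'1
    rw [hc'J J hJ] at hJ1
    unfold soloBlindIndVec at hJ1
    split_ifs at hJ1 <;> revert hJ1 <;> decide
  -- Conjecture E for the realisation
  have hmass := hE (soloBlind_quotMod_three L) h P σ zsf hgood
  -- the stars are distinct representations of σ
  have star_rep : ∀ v ∈ F, P.filter (fun J => v ∈ J) ∈ soloBlindSeqRepAll h P σ := by
    intro v hv
    rw [soloBlind_mem_seqRepAll]
    refine ⟨Finset.filter_subset _ _, ?_⟩
    rw [hσ, soloBlind_realise_sum, soloBlind_indVec_star, Submodule.mkQ_apply, Submodule.mkQ_apply,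
      Submodule.Quotient.eq]
    exact Submodule.subset_span ⟨⟨v, hv⟩, rfl⟩
  have star_inj : ∀ v ∈ F, ∀ w ∈ F, P.filter (fun J => v ∈ J) = P.filter (fun J => w ∈ J) → v = w := by
    intro v hv w hw hvw
    by_contra hne
    obtain ⟨J, hJ, hJsep⟩ := hsep v hv w hw hne
    apply hJsep
    constructor
    · intro hvJ
      have : J ∈ P.filter (fun J => w ∈ J) := hvw ▸ Finset.mem_filter.mpr ⟨hJ, hvJ⟩
      exact (Finset.mem_filter.mp this).2
    · intro hwJ
      have : J ∈ P.filter (fun J => v ∈ J) := hvw.symm ▸ Finset.mem_filter.mpr ⟨hJ, hwJ⟩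
      exact (Finset.mem_filter.mp this).2
  -- compare the Kraft sum with the mass
  calc soloBlindHgKraft F P
      = ∑ T ∈ F.image (fun v => P.filter (fun J => v ∈ J)), (1 / 2 : ℚ) ^ T.card := by
        unfold soloBlindHgKraft soloBlindHgDeg
        rw [Finset.sum_image (fun v hv w hw hvw => star_inj v hv w hw hvw)]
    _ ≤ soloBlindMass h P σ := by
        unfold soloBlindMass
        apply Finset.sum_le_sum_of_subset_of_nonneg
        · intro T hT
          obtain ⟨v, hv, rfl⟩ := Finset.mem_image.mp hT
          exact star_rep v hv
        · intro T _ _; positivity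
    _ ≤ 1 / 2 := hmass

/-- EQUIVALENCE (at matching universes): Conjecture E for all index types and exponent-`3` groups in `Type u`
holds iff the hypergraph Kraft conjecture holds over every vertex type in `Type u`. -/
theorem soloBlind_conjE_iff_hgKraft :
    (∀ {κ : Type u} {G' : Type u} [AddCommGroup G'] [DecidableEq G'],
      (∀ g : G', g + g + g = 0) → ∀ (h' : κ → G') (S' : Finset κ) (τ' : G'),
      (∀ T ⊆ S', T.Nonempty → ∑ i ∈ T, h' i ≠ 0) → (∀ T ⊆ S', ∑ i ∈ T, h' i ≠ τ' + τ') →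
      soloBlindMass h' S' τ' ≤ 1 / 2) ↔
    (∀ {W' : Type u} [DecidableEq W'], soloBlindHgKraftConj W') := by
  constructor
  · intro hE W' _
    exact soloBlind_hgKraft_of_conjE hE
  · intro hC κ G' _ _ three h' S' τ' zsf' hgood'
    classical
    exact soloBlind_conjE_of_hgKraft hC three h' S' τ' zsf' hgood'

end Summit.MatrixMultiplication.MatrixMultiplication.Theorems
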